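import Summits.QuantumFields.QCD.Theses.HeatSlicedQuarks
import Literature.MathematicalPhysics.QuantumFieldTheory.QuasiLocalGaugePerturbation
import Literature.MathematicalPhysics.QuantumFieldTheory.QCDGoldstoneBound

/-!
# Crux `InterleavedFlowProper` (stmt-QuantumFields-18031), line `Sketch` — the rev-3 handover, part 1:
# the corrected milestone, the block-gap target, the X₀-side landing pad, and the typed audit

(Part 2, `…StubCoerciveFormatInstantiate.lean`, proves the quantifier match
`coerciveFormat_instantiate : RobustYangMillsRG → CoerciveFormatMembership → BlockGapAlongQCDWeight` against rev 3 of
`HeavyThresholdYMBridge.RobustYangMillsRG`; it is split off because it is the only declaration that reads the route file's binder.)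


Skeleton namespace `Summit.QuantumFields.QCD.Cruxes.InterleavedFlowProper.OffsetLastFormatHandover` (lead
prover-line-stmt-QuantumFields-18031-0).  Gen-1 stub `stub_formatHandover : FormatHandover := RobustYangMillsRG → HeatSliceFormatMembership → ThresholdContinuumQCDExists`
was MIS-STATED by the 02:12Z restatement of the YM item and is retired in the gen-2 skeleton (`Cruxes/InterleavedFlowProper/Lines/Sketch.lean`):
its place is taken by `coerciveFormat_instantiate` (part 2) and the crux-sized `stub_continuumPackage` (audit below; long form in
the lead's `work/stubs/FormatHandoverAudit.md`). This file lands the registered glue stub `thresholdContinuumQCDExists_of_limitsAlong`.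

## What happened to the YM side while this stub was being worked

`RobustYangMillsRG` rev 2 (stmt-QuantumFields-14958), whose `let AdmAt` the milestone `HeatSliceFormatMembership` pastes
verbatim, was REFUTED in Lean at 01:45Z (`Summit.QuantumFields.QCD.Theorems.not_RobustYangMillsRG`: the `∃`-chosen,
merely measurable blocking map admits a wild Haar-to-Haar shear with fibre infimum `≡ 0`, so the `β = 0` Haar weight is
admissible for every `β₀` and the non-triviality conclusion fails) and RESTATED at 02:12Z as rev 3 =
stmt-QuantumFields-17812 under the SAME declaration name.  Rev 3 changes both ends of the handover:
* hypotheses: seven format constants (`ε r B₀ κ c₀` + coercivity `cA` + principal-norm bound `A₀`); `AdmAt w βe Bl k S`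
  takes the blocking map as an OUTER family; a NEW clause `∀ g U, w k S (gaugeTransform g U) = w k S U`; the principal
  part is `βe_k · A.total V` for a quasi-local analytic COERCIVE `A` (`cA · S_W(V) ≤ A(V) − A(1)`), no fibre infimum;
* conclusion: ONLY a volume-uniform exponential clustering in block units of bounded BLOCK observables read through `Bl`
  (`∃ Δ > 0, ∀ h, ∃ C, ∀ᶠ k, ∀ S ≥ L k, … ≤ C C₁ C₂ e^{−Δ ℓ₀ t}`) — no subsequence, no OS data, no species, no
  non-triviality (refuter findings A4/A5: the class is blind below `ℓ₀` and contains hypercubic-anisotropic RP families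
  with no `SO(4)`-invariant limit, so rev 2's OS conclusions were false for the class).
(The rev-2 match `RobustYangMillsRG → HeatSliceFormatMembership → ⟨14958's OS package at the QCD weight⟩` had been
kernel-checked by this worker at 01:55Z — `exact hYM' reg.a reg.L reg.a_pos reg.tendsto_a reg.tendsto_L ℓ₀ hℓ₀ _ βe hconv
hev` — and is now moot.)

## Proved here (sorry-free)

* `CoerciveFormatMembership` — the CORRECTED milestone: rev 3's `let AdmAt` pasted verbatim at the all-axes-antiperiodic
  quark-integrated Wilson weight, `Bl` an outer per-tuple family next to `βe`, and the physical-branch clause kept (K0).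
* `BlockGapAlongQCDWeight` — rev 3's conclusion copied verbatim for the QCD weight with the SAME `βe, Bl` (the target of the
  quantifier match `coerciveFormat_instantiate`, part 2).
* `thresholdContinuumQCDExists_of_limitsAlong : QCDLimitsAlongOneSubsequence → ThresholdContinuumQCDExists` — X₀-side
  landing pad: ONE `φ` of ONE regularisation for all tuples above `M₀`, the branch clause and convergence ALONG `φ` of
  X₀'s own periodic-quark functional `qcdLatticeSchwinger` give the threshold form of X₀ (`QCDRegularisation.restrict`).
* `curvature_F_eq_actionDensity` (`rfl`), `smearedInsertion_glue`: X₀'s smeared glue insertion IS `algebraMap` of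
  `smearedLatticeField (actionDensity ρ)` — glue strings are plain gauge expectations.

## AUDIT — `BlockGapAlongQCDWeight ⟶ QCDLimitsAlongOneSubsequence` is NOT provable; missing pieces as signatures

**(K0) MIS-STATEMENT 1, branch.** `IsQCDAlong` clause 2 wants `∀ fl, ∀ᶠ k, -1 < (reg.scheme m z shift).mq fl k`;
`BlockFormat` has `(∀ f, -1 < mass f k)` eventually, `formatMembership_of` drops it, `HeatSliceFormatMembership` is silent
and `AdmAt` cannot return it (`0 < ∫ w` holds far below the branch).  It must sit under the SAME `∃ M₀ ℓ₀ reg`: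
`∀ᶠ k in atTop, β₀ ≤ βe k ∧ (∀ f, -1 < mass f k) ∧ ∀ S, reg.L k ≤ S → AdmAt …` (done in `CoerciveFormatMembership`).

**(K∗) MIS-STATEMENT 2, format revision.** `HeatSliceFormatMembership` (rev-2 `AdmAt`) no longer feeds
`RobustYangMillsRG`; corrected stub: `FormatHandover := RobustYangMillsRG → CoerciveFormatMembership →
ThresholdContinuumQCDExists`.  Knock-on for the neighbours (not touched here): the fine-weight half needs the extra
clause `∀ g U, w (gaugeTransform g U) = w U` (true: `wilsonAction` and `fermionDet_wilsonDiracAP` are gauge invariant);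
the block half must deliver `Bl` AND a coercive quasi-local analytic principal part `A` with `cA · S_W ≤ A − A(1)`.

**(KΩ) the continuum package is now ENTIRELY line-side.**  Rev 3 hands back `∃ Δ > 0` and block-level clustering only.
To reach `QCDLimitsAlongOneSubsequence` the line must build, for the AP functional `qcdLatticeSchwingerAP4` (sigs file):
(Ω1) `k`-uniform bounds and subsequential limits of all smeared `n`-point functions (compactness — cheap given bounds);
(Ω2) the OS axioms of every limit as ONE `OSData (QCDField N_f) 4`: E2 from lattice RP of the AP functional, E3, E0'
(linear growth: `k`-uniform `(n!)^β` bounds), E4 from the block gap TRANSPORTED TO FINE OBSERVABLES (a smeared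
`actionDensity` or a quark line is not a function of `Bl U`: needs the format's control of sub-`ℓ₀` fluctuations,
exactly the A4 blind spot), and E1 — full `SO(4)` invariance — which no format statement can give (A5) and is the deep
weight-specific input; (Ω3) non-triviality and non-Gaussianity of glue AND `IsNontrivial (pseudoRe f g)`, none of them
YM-side any more.  Typed line-side target (rc 0, sigs file `Audit.QCDPackageAlongAPWeight`, K0/K4 folded in, K5 attached):
```
∀ Nf, Nf = 2 ∨ Nf = 3 → ∃ M₀ > 0, ∃ reg, reg.HasMassScaling ∧ (reg.scheme 0 0 0).HasAsymptoticScaling ∧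
  ∃ φ, StrictMono φ ∧ ∀ m, (∀ f, M₀ < m f) → (∀ fl, ∀ᶠ k in atTop, -1 < reg.mcrit k + reg.a k * m fl / reg.Zm k) ∧
    ∃ z shift (T : OSData (QCDField Nf) 4), (∀ n ≠ 0, ∀ σ f F, IsTensorOf F (fun i => ofRealTest (f i)) →
      IsOffDiagonal F → Tendsto (fun j => qcdLatticeSchwingerAP4 (reg.scheme m z shift) (φ j) n σ f) atTop
        (𝓝 (T.schwinger n σ F))) ∧ APPeriodicComparisonAt reg φ m z shift ∧
      T.IsNontrivial glue ∧ T.IsNonGaussian glue ∧ ∀ f g, f ≠ g → T.IsNontrivial (pseudoRe f g)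
```
(`limitsAlong_of_APPackage` in the sigs file proves it implies `QCDLimitsAlongOneSubsequence`; `qcdLatticeSchwingerAP4` =
`qcdLatticeSchwinger` with the Grassmann Gaussian of `⊕_f QuantumLattice.wilsonDiracAP U (m_f(k))`, `apLift` ≡ `apU`).

**(K3) quark lines, (K4) one subsequence, (K5) periodic vs antiperiodic** — unchanged from the rev-2 audit and still
needed inside (KΩ): quark-bilinear strings are Wick sums of propagator products along quark lines, not products of
one-point lattice fields (K3); the extraction `φ` must serve all tuples (K4: `QCDRegularisation.restrict`, Lindelöf +
diagonal `CertifiedSeaThresholdGraft.stub_diagonal`, analytic input = local `m`-uniformity, typed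
`Audit.MassLocallyUniformAPPackage`); and `IsQCDAlong` reads the PERIODIC-quark functional while `AdmAt` forces all-axes
AP (typed `Audit.APPeriodicComparisonAt`: one wrapping heavy line, `O(e^{−c M₀ a_k(2L_k+1)})` against `∏ z_{σᵢ}(k)` — a
volume-growth side condition on `reg.L`).

**(glue)** `r₃.curvature.F = actionDensity ρ` by `rfl` and `smearedInsertion sch k U glue f = algebraMap
(smearedLatticeField (actionDensity ρ) (box 4 (L k)) (a k) (z glue k) (shift glue k) f Ũ)`; for glue-only strings the
scalars leave the Berezin integral (sigs file `Audit.qcdLatticeSchwingerAP4_glue`, proved), so glue correlators are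
normalised gauge expectations `E` of products of FINE smeared action densities — covered by rev 3's clustering only after
the fine-to-block transport of (Ω2).
-/

noncomputable section

namespace Summit.QuantumFields.QCD.Cruxes.InterleavedFlowProper.OffsetLastFormatHandover

open Summit.QuantumFields.QCD.Theses.HeatSlicedQuarks
open Literature.MathematicalPhysics.QuantumFieldTheory Literature.MathematicalPhysics.QuantumLattice
  Literature.MathematicalPhysics.AQFT
open Filter Topology MeasureTheory

/-! ## §0 Skeleton-local definition of line `Sketch` (copied verbatim) -/

/-- Heavy-threshold form of the route target X₀ = `ContinuumQCDExists`: the flavour-blind RGI offset `M₀`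
is made explicit (skeleton-local definition of line `Sketch`, copied verbatim). -/
def ThresholdContinuumQCDExists : Prop :=
  ∀ Nf : ℕ, Nf = 2 ∨ Nf = 3 → ∃ M₀ : ℝ, 0 ≤ M₀ ∧ ∃ reg : QCDRegularisation Nf, reg.HasMassScaling ∧
    ∀ m : Fin Nf → ℝ, (∀ f, M₀ < m f) →
      ∃ (z shift : QCDField Nf → ℕ → ℝ) (T : OSData (QCDField Nf) 4),
        IsQCDAlong (reg.scheme m z shift) T ∧ T.IsNontrivial QCDField.glue ∧
          T.IsNonGaussian QCDField.glue ∧ ∀ f g : Fin Nf, f ≠ g → T.IsNontrivial (QCDField.pseudoRe f g)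

/-! ## §1 The corrected milestone and STEP 1 — the quantifier match with the LIVE YM item (rev 3) -/

/-- **The CORRECTED milestone (rev 3 of the YM-side format): the heavy-offset QCD weight is in COERCIVE Bałaban
format.**  `AdmAt` below is the `let AdmAt` binder of `HeavyThresholdYMBridge.RobustYangMillsRG` REV 3 (item
stmt-QuantumFields-17812, 2026-08-17T02:12Z; rev 2 = stmt-QuantumFields-14958 was refuted in Lean,
`not_RobustYangMillsRG`: an `∃`-chosen merely measurable blocking map made the `β = 0` Haar weight admissible) copied
VERBATIM: seven format constants (`ε r B₀ κ c₀` and the NEW coercivity `cA`, principal-norm bound `A₀`), the blocking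
map `Bl` is an OUTER family quantified with `w, βe`, gauge invariance of `w` is a NEW clause, and the principal part is
`βe_k · A.total V` for a quasi-local analytic COERCIVE `A` (`cA · S_W(V) ≤ A(V) − A(1)`) instead of rev 2's fibre infimum.
The weight `w` is the all-axes-antiperiodic quark-integrated Wilson weight at bare masses
`m_crit(k) + a_k (M₀ + mr_f)/Z_m(k)` (unchanged), and the eventual clause KEEPS the physical branch `-1 < mass f k`
(audit K0).  Quantifier order = the lever: format constants → `β₀` → `M₀, ℓ₀, reg` → mass tuple → `βe, Bl`. -/
def CoerciveFormatMembership : Prop :=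
  let G := ↥(Matrix.specialUnitaryGroup (Fin 3) ℂ)
  let ρ : G →* Matrix (Fin 3) (Fin 3) ℂ := fundamentalRep (Fin 3)
  ∀ Nf : ℕ, Nf = 2 ∨ Nf = 3 →
    ∃ ε r B₀ κ c₀ cA A₀ : ℝ, 0 < ε ∧ 0 < r ∧ 0 < B₀ ∧ 0 < κ ∧ 0 < c₀ ∧ 0 < cA ∧ 0 < A₀ ∧
    ∀ β₀ : ℝ, ∃ M₀ ℓ₀ : ℝ, 0 < M₀ ∧ 0 < ℓ₀ ∧
    ∃ reg : QCDRegularisation Nf, reg.HasMassScaling ∧ (reg.scheme 0 0 0).HasAsymptoticScaling ∧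
    ∀ mr : Fin Nf → ℝ, (∀ f, 0 < mr f) →
    let a : ℕ → ℝ := reg.a
    let b : ℕ → ℕ := fun k => ⌊ℓ₀ / a k⌋₊
    let N : ℕ → ℕ := fun S => 2 * S + 1
    let M : ℕ → ℕ → ℕ := fun k S => N S / b k - 1 + 1
    let cor : (k S : ℕ) → Site 4 (M k S) → Site 4 (N S) :=
      fun k S y i => ((N S * (y i).val / M k S : ℕ) : ZMod (N S))
    let μ : (n : ℕ) → [NeZero n] → Measure (GaugeConfig 4 n G) :=
      fun _ _ => Measure.pi fun _ => haarProbability G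
    let LF : (k S : ℕ) → GaugeConfig 4 (M k S) G → Finset (Site 4 (M k S)) :=
      fun _ _ V => Finset.univ.filter fun y => ∃ i j : Fin 4, ε < 3 - (ρ (plaquetteHolonomy V y i j)).trace.re
    let AdmAt : ((k S : ℕ) → GaugeConfig 4 (N S) G → ℝ) → (ℕ → ℝ) →
        ((k S : ℕ) → GaugeConfig 4 (N S) G → GaugeConfig 4 (M k S) G) → ℕ → ℕ → Prop := fun w βe Bl k S =>
      Measurable (w k S) ∧ (0 < ∫ U, w k S U ∂(μ (N S))) ∧
      (∀ g U, w k S (gaugeTransform g U) = w k S U) ∧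
      (∀ v U, w k S (torusConfigShift v U) = w k S U) ∧
      (∀ U, w k S (GaugeConfig.timeReflect U) = w k S U) ∧
      (∀ (π : Equiv.Perm (Fin 4)) U, w k S (U ∘ fun e => (e.1 ∘ π, π.symm e.2)) = w k S U) ∧
      (∀ F : GaugeConfig 4 (N S) G → ℝ, Measurable F → (∃ C, ∀ U, |F U| ≤ C) →
        IsPositiveTimeObservable F → 0 ≤ ∫ U, F U.timeReflect * F U * w k S U ∂(μ (N S))) ∧
      Measurable (Bl k S) ∧ (∀ g U, Bl k S (gaugeTransform g U) = gaugeTransform (g ∘ cor k S) (Bl k S U)) ∧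
      (∀ e, DependsOn (fun U => Bl k S U e)
        {e' | ∀ i, (e'.1 i - cor k S e.1 i).val ≤ 5 * b k ∨ (cor k S e.1 i - e'.1 i).val ≤ 5 * b k}) ∧
      ∃ (A W : QuasiLocalGaugePerturbation 4 (M k S) G 1)
        (F : Finset (Site 4 (M k S)) → GaugeConfig 4 (M k S) G → ℝ),
        A.HasAnalyticNormLE ρ (smallFieldDomain ρ 1 r ε) κ A₀ ∧ A.NormLE κ A₀ ∧
        (∀ X ∈ polymers 1, (∃ V, A.act X V ≠ 0) →
          ∀ y ∈ X, ∀ y' ∈ X, ∀ i, (y i - y' i).val ≤ X.card ∨ (y' i - y i).val ≤ X.card) ∧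
        (∀ V, cA * wilsonAction ρ V ≤ A.total V - A.total fun _ => 1) ∧
        W.HasAnalyticNormLE ρ (smallFieldDomain ρ 1 r ε) κ B₀ ∧ W.NormLE κ B₀ ∧
        (∀ X ∈ polymers 1, (∃ V, W.act X V ≠ 0) →
          ∀ y ∈ X, ∀ y' ∈ X, ∀ i, (y i - y' i).val ≤ X.card ∨ (y' i - y i).val ≤ X.card) ∧
        (∀ Z, Measurable (F Z)) ∧ (∀ V, F ∅ V = 1) ∧ (∀ Z V, |F Z V| ≤ Real.exp (c₀ * Z.card)) ∧
        (∀ Z (n : ℕ) V V', (∀ e, (∃ y ∈ Z, ∀ i, (e.1 i - y i).val ≤ n ∨ (y i - e.1 i).val ≤ n) → V e = V' e) →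
          |F Z V - F Z V'| ≤ Real.exp (c₀ * Z.card + κ * (4 - n))) ∧
        (∀ Z₁ Z₂ (n : ℕ), (∀ y ∈ Z₁, ∀ y' ∈ Z₂, ∃ i, n < (y i - y' i).val ∧ n < (y' i - y i).val) →
          ∀ V, |F (Z₁ ∪ Z₂) V - F Z₁ V * F Z₂ V| ≤ Real.exp (c₀ * (Z₁.card + Z₂.card) + κ * (4 - n))) ∧
        ∀ Gf, Measurable Gf → (∃ C, ∀ V, |Gf V| ≤ C) →
          ∫ U, Gf (Bl k S U) * w k S U ∂(μ (N S)) =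
            ∫ V, Gf V * (Real.exp (-(βe k * A.total V) - W.total V) * F (LF k S V) V) ∂(μ (M k S))
    let apU : (n : ℕ) → GaugeConfig 4 n G → GaugeConfig 4 n (Matrix.unitaryGroup (Fin 3) ℂ) := fun _ U e =>
      if e.1 e.2 = -1 then -(⟨(U e).1, Matrix.specialUnitaryGroup_le_unitaryGroup (U e).2⟩ :
        Matrix.unitaryGroup (Fin 3) ℂ) else ⟨(U e).1, Matrix.specialUnitaryGroup_le_unitaryGroup (U e).2⟩
    let mass : Fin Nf → ℕ → ℝ := fun f k => reg.mcrit k + reg.a k * (M₀ + mr f) / reg.Zm k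
    let w : (k S : ℕ) → GaugeConfig 4 (N S) G → ℝ := fun k S U =>
      Real.exp (-(reg.β k * wilsonAction ρ U)) *
        (∏ f, fermionDet (wilsonDirac (unitaryFundamentalRep (Fin 3) ℂ) (apU (N S) U) (mass f k) 1)).re
    ∃ (βe : ℕ → ℝ) (Bl : (k S : ℕ) → GaugeConfig 4 (N S) G → GaugeConfig 4 (M k S) G),
      (∃ βl, Tendsto βe atTop (nhds βl)) ∧
      ∀ᶠ k in atTop, β₀ ≤ βe k ∧ (∀ f, -1 < mass f k) ∧ ∀ S, reg.L k ≤ S → AdmAt w βe Bl k S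

/-- **What rev 3 of the YM-side item returns along the QCD weight** — its conclusion
(`let E := …; ∃ Δ > 0, ∀ h, ∃ C, ∀ᶠ k, ∀ S ≥ L k, …`, copied verbatim with `L := reg.L`): a volume-uniform exponential
clustering IN BLOCK UNITS (`e^{−Δ ℓ₀ t}`) of all pairs of bounded measurable BLOCK observables of time-slab height `h`,
read through the blocking map `Bl` of the milestone, under the normalised signed expectation `E` of the QCD weight —
together with the milestone's own data `βe, Bl` (same witnesses), its eventual admissibility and the physical branch.
NO subsequence, NO OS data, NO species renormalisations, NO non-triviality: since rev 3 the YM side certifies only the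
gapped phase of the blocked theory. -/
def BlockGapAlongQCDWeight : Prop :=
  let G := ↥(Matrix.specialUnitaryGroup (Fin 3) ℂ)
  let ρ : G →* Matrix (Fin 3) (Fin 3) ℂ := fundamentalRep (Fin 3)
  ∀ Nf : ℕ, Nf = 2 ∨ Nf = 3 →
    ∃ ε r B₀ κ c₀ cA A₀ : ℝ, 0 < ε ∧ 0 < r ∧ 0 < B₀ ∧ 0 < κ ∧ 0 < c₀ ∧ 0 < cA ∧ 0 < A₀ ∧
    ∃ β₀ M₀ ℓ₀ : ℝ, 0 < M₀ ∧ 0 < ℓ₀ ∧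
    ∃ reg : QCDRegularisation Nf, reg.HasMassScaling ∧ (reg.scheme 0 0 0).HasAsymptoticScaling ∧
    ∀ mr : Fin Nf → ℝ, (∀ f, 0 < mr f) →
    let a : ℕ → ℝ := reg.a
    let b : ℕ → ℕ := fun k => ⌊ℓ₀ / a k⌋₊
    let N : ℕ → ℕ := fun S => 2 * S + 1
    let M : ℕ → ℕ → ℕ := fun k S => N S / b k - 1 + 1
    let cor : (k S : ℕ) → Site 4 (M k S) → Site 4 (N S) :=
      fun k S y i => ((N S * (y i).val / M k S : ℕ) : ZMod (N S))
    let μ : (n : ℕ) → [NeZero n] → Measure (GaugeConfig 4 n G) :=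
      fun _ _ => Measure.pi fun _ => haarProbability G
    let LF : (k S : ℕ) → GaugeConfig 4 (M k S) G → Finset (Site 4 (M k S)) :=
      fun _ _ V => Finset.univ.filter fun y => ∃ i j : Fin 4, ε < 3 - (ρ (plaquetteHolonomy V y i j)).trace.re
    let AdmAt : ((k S : ℕ) → GaugeConfig 4 (N S) G → ℝ) → (ℕ → ℝ) →
        ((k S : ℕ) → GaugeConfig 4 (N S) G → GaugeConfig 4 (M k S) G) → ℕ → ℕ → Prop := fun w βe Bl k S =>
      Measurable (w k S) ∧ (0 < ∫ U, w k S U ∂(μ (N S))) ∧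
      (∀ g U, w k S (gaugeTransform g U) = w k S U) ∧
      (∀ v U, w k S (torusConfigShift v U) = w k S U) ∧
      (∀ U, w k S (GaugeConfig.timeReflect U) = w k S U) ∧
      (∀ (π : Equiv.Perm (Fin 4)) U, w k S (U ∘ fun e => (e.1 ∘ π, π.symm e.2)) = w k S U) ∧
      (∀ F : GaugeConfig 4 (N S) G → ℝ, Measurable F → (∃ C, ∀ U, |F U| ≤ C) →
        IsPositiveTimeObservable F → 0 ≤ ∫ U, F U.timeReflect * F U * w k S U ∂(μ (N S))) ∧
      Measurable (Bl k S) ∧ (∀ g U, Bl k S (gaugeTransform g U) = gaugeTransform (g ∘ cor k S) (Bl k S U)) ∧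
      (∀ e, DependsOn (fun U => Bl k S U e)
        {e' | ∀ i, (e'.1 i - cor k S e.1 i).val ≤ 5 * b k ∨ (cor k S e.1 i - e'.1 i).val ≤ 5 * b k}) ∧
      ∃ (A W : QuasiLocalGaugePerturbation 4 (M k S) G 1)
        (F : Finset (Site 4 (M k S)) → GaugeConfig 4 (M k S) G → ℝ),
        A.HasAnalyticNormLE ρ (smallFieldDomain ρ 1 r ε) κ A₀ ∧ A.NormLE κ A₀ ∧
        (∀ X ∈ polymers 1, (∃ V, A.act X V ≠ 0) →
          ∀ y ∈ X, ∀ y' ∈ X, ∀ i, (y i - y' i).val ≤ X.card ∨ (y' i - y i).val ≤ X.card) ∧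
        (∀ V, cA * wilsonAction ρ V ≤ A.total V - A.total fun _ => 1) ∧
        W.HasAnalyticNormLE ρ (smallFieldDomain ρ 1 r ε) κ B₀ ∧ W.NormLE κ B₀ ∧
        (∀ X ∈ polymers 1, (∃ V, W.act X V ≠ 0) →
          ∀ y ∈ X, ∀ y' ∈ X, ∀ i, (y i - y' i).val ≤ X.card ∨ (y' i - y i).val ≤ X.card) ∧
        (∀ Z, Measurable (F Z)) ∧ (∀ V, F ∅ V = 1) ∧ (∀ Z V, |F Z V| ≤ Real.exp (c₀ * Z.card)) ∧
        (∀ Z (n : ℕ) V V', (∀ e, (∃ y ∈ Z, ∀ i, (e.1 i - y i).val ≤ n ∨ (y i - e.1 i).val ≤ n) → V e = V' e) →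
          |F Z V - F Z V'| ≤ Real.exp (c₀ * Z.card + κ * (4 - n))) ∧
        (∀ Z₁ Z₂ (n : ℕ), (∀ y ∈ Z₁, ∀ y' ∈ Z₂, ∃ i, n < (y i - y' i).val ∧ n < (y' i - y i).val) →
          ∀ V, |F (Z₁ ∪ Z₂) V - F Z₁ V * F Z₂ V| ≤ Real.exp (c₀ * (Z₁.card + Z₂.card) + κ * (4 - n))) ∧
        ∀ Gf, Measurable Gf → (∃ C, ∀ V, |Gf V| ≤ C) →
          ∫ U, Gf (Bl k S U) * w k S U ∂(μ (N S)) =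
            ∫ V, Gf V * (Real.exp (-(βe k * A.total V) - W.total V) * F (LF k S V) V) ∂(μ (M k S))
    let apU : (n : ℕ) → GaugeConfig 4 n G → GaugeConfig 4 n (Matrix.unitaryGroup (Fin 3) ℂ) := fun _ U e =>
      if e.1 e.2 = -1 then -(⟨(U e).1, Matrix.specialUnitaryGroup_le_unitaryGroup (U e).2⟩ :
        Matrix.unitaryGroup (Fin 3) ℂ) else ⟨(U e).1, Matrix.specialUnitaryGroup_le_unitaryGroup (U e).2⟩
    let mass : Fin Nf → ℕ → ℝ := fun f k => reg.mcrit k + reg.a k * (M₀ + mr f) / reg.Zm k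
    let w : (k S : ℕ) → GaugeConfig 4 (N S) G → ℝ := fun k S U =>
      Real.exp (-(reg.β k * wilsonAction ρ U)) *
        (∏ f, fermionDet (wilsonDirac (unitaryFundamentalRep (Fin 3) ℂ) (apU (N S) U) (mass f k) 1)).re
    let E : (k S : ℕ) → (GaugeConfig 4 (N S) G → ℝ) → ℝ := fun k S h =>
      (∫ U, h U * w k S U ∂(μ (N S))) / ∫ U, w k S U ∂(μ (N S))
    ∃ (βe : ℕ → ℝ) (Bl : (k S : ℕ) → GaugeConfig 4 (N S) G → GaugeConfig 4 (M k S) G),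
      (∃ βl, Tendsto βe atTop (nhds βl)) ∧
      (∀ᶠ k in atTop, β₀ ≤ βe k ∧ (∀ f, -1 < mass f k) ∧ ∀ S, reg.L k ≤ S → AdmAt w βe Bl k S) ∧
    ∃ Δ : ℝ, 0 < Δ ∧ ∀ h : ℕ, ∃ C : ℝ, ∀ᶠ k in atTop, ∀ S, reg.L k ≤ S →
      ∀ (t : ℕ) (G₁ G₂ : GaugeConfig 4 (M k S) G → ℝ) (C₁ C₂ : ℝ), 2 * t ≤ M k S → Measurable G₁ → Measurable G₂ →
        (∀ V, |G₁ V| ≤ C₁) → (∀ V, |G₂ V| ≤ C₂) →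
        DependsOn G₁ {e | (e.1 0).val < h} → DependsOn G₂ {e | (e.1 0).val < h} →
          |E k S (fun U => G₁ (Bl k S U) * G₂ (torusConfigShift (Pi.single 0 (t : ZMod (M k S))) (Bl k S U))) -
              E k S (fun U => G₁ (Bl k S U)) *
                E k S (fun U => G₂ (torusConfigShift (Pi.single 0 (t : ZMod (M k S))) (Bl k S U)))| ≤
            C * C₁ * C₂ * Real.exp (-(Δ * (ℓ₀ * t)))

/-! ## §2 The landing pad on the X₀ side (K4/K5 bookkeeping, proved) -/

/-- **The handover-ready target on the X₀ side**: for `N_f ∈ {2,3}` an offset `M₀ ≥ 0`, ONE mass-independent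
regularisation `reg` (with `HasMassScaling`, asymptotically scaling) and ONE strictly increasing `φ` such that for
every mass tuple above `M₀` the bare trajectory is eventually on the physical branch and X₀'s own periodic-quark
lattice Schwinger functions `qcdLatticeSchwinger (reg.scheme m z shift)` converge ALONG `φ` to OS data over
`QCDField N_f` with non-trivial non-Gaussian glue and non-trivial flavour-changing pseudoscalars.  This is what
the line-side package (KΩ, with K3/K5 inside) delivers; (K4) is the single `φ` in front of `∀ m`. -/
def QCDLimitsAlongOneSubsequence : Prop :=
  ∀ Nf : ℕ, Nf = 2 ∨ Nf = 3 → ∃ M₀ : ℝ, 0 ≤ M₀ ∧ ∃ reg : QCDRegularisation Nf, reg.HasMassScaling ∧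
    (reg.scheme 0 0 0).HasAsymptoticScaling ∧ ∃ φ : ℕ → ℕ, StrictMono φ ∧
    ∀ m : Fin Nf → ℝ, (∀ f, M₀ < m f) →
      (∀ fl, ∀ᶠ k in atTop, -1 < reg.mcrit k + reg.a k * m fl / reg.Zm k) ∧
      ∃ (z shift : QCDField Nf → ℕ → ℝ) (T : OSData (QCDField Nf) 4),
        (∀ n : ℕ, n ≠ 0 → ∀ (σ : Fin n → QCDField Nf) (f : Fin n → SchwartzMap (EuclideanSpace ℝ (Fin 4)) ℝ)
          (F : SchwartzMap (Fin n → EuclideanSpace ℝ (Fin 4)) ℂ),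
          IsTensorOf F (fun i => ofRealTest (f i)) → IsOffDiagonal F →
            Tendsto (fun j => qcdLatticeSchwinger (reg.scheme m z shift) (φ j) n σ f) atTop
              (𝓝 (T.schwinger n σ F))) ∧
        T.IsNontrivial QCDField.glue ∧ T.IsNonGaussian QCDField.glue ∧
          ∀ f g : Fin Nf, f ≠ g → T.IsNontrivial (QCDField.pseudoRe f g)

/-- Leading-log mass scaling passes to the sub-regularisation `reg.restrict φ` (`Z_m`, `a` composed with `φ`). -/
theorem hasMassScaling_restrict {Nf : ℕ} (reg : QCDRegularisation Nf) (φ : ℕ → ℕ) (hφ : StrictMono φ)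
    (h : reg.HasMassScaling) : (reg.restrict φ hφ.tendsto_atTop).HasMassScaling := by
  obtain ⟨c, hc, ht⟩ := h
  exact ⟨c, hc, ht.comp hφ.tendsto_atTop⟩

/-- Two-loop asymptotic scaling passes to the sub-regularisation (`β`, `a` composed with `φ`; the clause does not
read `m, z, shift`). -/
theorem hasAsymptoticScaling_restrict {Nf : ℕ} (reg : QCDRegularisation Nf) (φ : ℕ → ℕ) (hφ : StrictMono φ)
    {m m' : Fin Nf → ℝ} {z shift z' shift' : QCDField Nf → ℕ → ℝ}
    (h : (reg.scheme m z shift).HasAsymptoticScaling) :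
    ((reg.restrict φ hφ.tendsto_atTop).scheme m' z' shift').HasAsymptoticScaling := by
  obtain ⟨Λ, hΛ, ht⟩ := h
  exact ⟨Λ, hΛ, ht.comp hφ.tendsto_atTop⟩

/-- **`IsQCDAlong` along a subsequence from convergence along it**: if the scheme `reg.scheme m z shift` scales
asymptotically, its bare masses are eventually on the physical branch, and its lattice Schwinger functions converge
to `T` ALONG `φ`, then `T` is QCD along the sub-regularisation `reg.restrict φ` with the species renormalisations
reindexed (`qcdLatticeSchwinger` reads the scheme through its `k`-th data, definitionally). -/
theorem isQCDAlong_restrict_of_tendsto {Nf : ℕ} (reg : QCDRegularisation Nf) (φ : ℕ → ℕ) (hφ : StrictMono φ)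
    (m : Fin Nf → ℝ) (z shift : QCDField Nf → ℕ → ℝ) (T : OSData (QCDField Nf) 4)
    (has : (reg.scheme m z shift).HasAsymptoticScaling)
    (hbr : ∀ fl, ∀ᶠ k in atTop, -1 < (reg.scheme m z shift).mq fl k)
    (hconv : ∀ n : ℕ, n ≠ 0 → ∀ (σ : Fin n → QCDField Nf) (f : Fin n → SchwartzMap (EuclideanSpace ℝ (Fin 4)) ℝ)
      (F : SchwartzMap (Fin n → EuclideanSpace ℝ (Fin 4)) ℂ),
      IsTensorOf F (fun i => ofRealTest (f i)) → IsOffDiagonal F →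
        Tendsto (fun j => qcdLatticeSchwinger (reg.scheme m z shift) (φ j) n σ f) atTop (𝓝 (T.schwinger n σ F))) :
    IsQCDAlong ((reg.restrict φ hφ.tendsto_atTop).scheme m (fun s => z s ∘ φ) (fun s => shift s ∘ φ)) T :=
  ⟨hasAsymptoticScaling_restrict reg φ hφ has, fun fl => hφ.tendsto_atTop.eventually (hbr fl),
    fun n hn σ f F hF hoff => hconv n hn σ f F hF hoff⟩

/-- **Landing pad: `QCDLimitsAlongOneSubsequence → ThresholdContinuumQCDExists`.**  Pass to the sub-regularisation
`reg.restrict φ` (one `φ` for all mass tuples — this is where K4 is consumed), reindex the species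
renormalisations, and read `IsQCDAlong` off `isQCDAlong_restrict_of_tendsto`; the `T`-side clauses do not mention
the scheme. -/
theorem thresholdContinuumQCDExists_of_limitsAlong :
    QCDLimitsAlongOneSubsequence → ThresholdContinuumQCDExists := by
  intro h Nf hNf
  obtain ⟨M₀, hM₀, reg, hms, has, φ, hφ, hall⟩ := h Nf hNf
  refine ⟨M₀, hM₀, reg.restrict φ hφ.tendsto_atTop, hasMassScaling_restrict reg φ hφ hms, fun m hm => ?_⟩
  obtain ⟨hbr, z, shift, T, hconv, hN, hG, hP⟩ := hall m hm
  exact ⟨fun s => z s ∘ φ, fun s => shift s ∘ φ, T,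
    isQCDAlong_restrict_of_tendsto reg φ hφ m z shift T (hasAsymptoticScaling_restrict reg _ strictMono_id has)
      hbr hconv, hN, hG, hP⟩

/-! ## §3 Glue bookkeeping (proved): the curvature species / X₀'s glue field is the smeared action density -/

/-- **`r₃.curvature.F = actionDensity ρ`, definitionally**: the curvature species of the Yang–Mills OS statements
(`YangMills`, `RobustYangMills`, rev 2 of `RobustYangMillsRG`) is the Wilson action density at the origin in the
fundamental representation — the same lattice field as X₀'s `insertion U QCDField.glue x = algebraMap ℂ _
(actionDensity ρ (τ₋ₓ Ũ))`. -/
theorem curvature_F_eq_actionDensity :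
    ((⟨3, fundamentalRep (Fin 3), continuous_fundamentalRep _, fundamentalRep_injective _,
        fundamentalRep_mem_unitaryGroup⟩ : LatticeRep ↥(Matrix.specialUnitaryGroup (Fin 3) ℂ)).curvature).F =
      actionDensity (fundamentalRep (Fin 3)) :=
  rfl

/-- **X₀'s smeared glue insertion is 14958's smeared curvature field, as a scalar in the quark Grassmann algebra**:
`Φ_k^{glue}(f)(U) = algebraMap (c a⁴ ∑ₓ f(a x) (actionDensity ρ (τ₋ₓ Ũ) − m))` with `c := z glue k`,
`m := shift glue k`, i.e. `algebraMap (smearedLatticeField (actionDensity ρ) (box 4 L_k) a_k (z glue k) (shift glue k) f Ũ)`.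
Consequently glue-only lattice `n`-point functions of ANY Grassmann-Gaussian quark weight are normalised gauge
expectations of `∏ᵢ smearedLatticeField r₃.curvature.F …` against the fermion-integrated weight (the scalars leave
the Berezin integral) — the functional `E` of `RobustYangMillsRG` applied to FINE smeared fields. -/
theorem smearedInsertion_glue {Nf : ℕ} (sch : QCDScheme Nf) (k : ℕ)
    (U : GaugeConfig 4 (sch.side k) ↥(Matrix.specialUnitaryGroup (Fin 3) ℂ))
    (f : SchwartzMap (EuclideanSpace ℝ (Fin 4)) ℝ) :
    smearedInsertion sch k U QCDField.glue f =
      algebraMap ℂ (FermiAlg Nf (sch.side k))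
        ((smearedLatticeField (actionDensity (fundamentalRep (Fin 3)))
            (Literature.Probability.LatticeModels.box 4 (sch.L k)) (sch.a k) (sch.z QCDField.glue k)
            (sch.shift QCDField.glue k) f (torusLift (sch.side k) U) : ℝ) : ℂ) := by
  simp only [smearedInsertion, insertion, smearedLatticeField, Finset.mul_sum]
  push_cast
  rw [map_sum]
  refine Finset.sum_congr rfl fun x _ => ?_
  rw [Algebra.smul_def, ← map_sub, ← map_mul]
  congr 1
  ring

end Summit.QuantumFields.QCD.Cruxes.InterleavedFlowProper.OffsetLastFormatHandover

end
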